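import Summits.QuantumFields.YangMills.Theorems.BalabanUVNodesN15KingModelPerturbedLeaves
import Summits.QuantumFields.YangMills.Theorems.BalabanUVNodesN15KingModelContinuum

/-!
# Route «BalabanUVNodes» (K4 «SpineRates»), node N15 = NE2 — THE KING-MODEL RUNG, part 7a: THE SANDWICH RATE — η-RATES OF `P′_kE_kQ_k` FOR TWO TOWERS
# OF DECAYING COVARIANCES AROUND A LOCAL PERTURBATION TOWER; hence the η-rate of the FIRST-ORDER background term `(D_k+B)⁻¹E_k(D_k+B)⁻¹` and of the
# BACKGROUND-DEPENDENT PART `(D_k+E_k+B)⁻¹ − (D_k+B)⁻¹` of a dressed covariance, BOTH LINEAR IN THE PERTURBATION'S SIZE, decay kept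
# (position-space currency, any finite index set)

Cell `pub-ymgap`, Track A (D-0062), seat `pub-ymgap-dag-n15-d` (R134 seat, strategy s3 «King 1986 Lemma 4.5 (4.38) as the scalar kernel», gen 5;
dag-lead FAN-OUT v1.2 §N15 s3 «KING-MODEL RUNG»).  `bears_on: R4∕N15`; `--supports` the K3′ item `SpineGivenEndpointR12` (stmt-QuantumFields-19908,
rev 15).  COUNT-NEUTRAL; THEOREMS ONLY (0 `def`, 0 `sorry`, standard axioms).

WHY THIS FILE.  Parts 6a–6c dressed King's tower by a k-uniformly LOCAL perturbation tower `E` with a geometric one-step rate and proved: (4.38) for the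
dressed tower UNIFORMLY over the backgrounds of size `≤ c̄` (`covarianceTowerRate_add_of_leaves`), and background-LIPSCHITZ continuity at every level and
in the limit (`inv_sub_inv_perturbed_le`, `kingCovE_lipschitz`, `kingCovLimE_lipschitz`).  What an expansion IN THE BACKGROUND of the η → 0 limit needs
next is the JOINT statement — the η-rate of the background-dependent part is itself SMALL IN THE BACKGROUND: in the Spine's operator-norm currency this
is the pair «rate uniform in the coupling `t`» ∧ «holomorphy in `t`» (`Spine.NE2PerturbedLayer.pertCov_sub_le`, `Support.PerturbedLimitAnalytic.
differentiableOn_pertLim`), from which the rate of the `t`-derivative follows by Cauchy estimates; in POSITION SPACE WITH DECAY there is no such package in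
the tree.  THIS FILE proves it directly, for any finite index set with a pseudo-metric:
§1 kernel algebra — composition of two decaying kernels when one factor has a Combes–Thomas surplus `κ∕2` (`mul_entry_decay_right`∕`_left`:
`|(PQ)(x,y)| ≤ pqV·e^{−δd(x,y)}`), the three-term telescoping identity `P′₁E₁Q₁ − P′₀E₀Q₀ = (P′₁−P′₀)E₁Q₁ + P′₀(E₁−E₀)Q₁ + P′₀E₀(Q₁−Q₀)`
(`sandwich_telescope`), and the perturbation's one-step difference WITH decay from its two letters (`oneStep_decay_of_letters`:
`|E_{k+1} − E_k| ≤ √(2ε_Ec_E)(√r)^k e^{−κd}`, King's `min ≤ geometric mean` step `King1986.abs_le_sqrt_mul_exp_half`);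
§2 **`sandwich_rate`** — for towers `P′, Q` decaying at rate `κ` with one-step rates `c′s^k, cs^k` at decay `κ∕2`, and a middle tower `E` local at `2κ` (size
`c_E`) with one-step rate `e_Es^k` at decay `κ`: `|(P′_{k+1}E_{k+1}Q_{k+1} − P′_kE_kQ_k)(x,y)| ≤ (c′c_Ea + a′e_Ea + a′c_Ec)·V²·s^k·e^{−(κ∕2)d(x,y)}`;
§3 the two instances on the five leaves of a tower `D` (b2b's socket `Spine.NE2KingTransplant`) plus the two letters of `E`:
**`firstOrder_rate_of_leaves`** (the FIRST-ORDER TERM `F_k = (D_k+B)⁻¹E_k(D_k+B)⁻¹ = −∂_t(D_k+tE_k+B)⁻¹|_{t=0}`: `|F_{k+1} − F_k| ≤ (c_E·K₁ + √(2ε_Ec_E)·K₂)(√r)^k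
e^{−(κ∕2)d}`) and **`mixed_rate_of_leaves`** (the BACKGROUND-DEPENDENT PART `G_k = (D_k+E_k+B)⁻¹ − (D_k+B)⁻¹ = −(D_k+E_k+B)⁻¹E_k(D_k+B)⁻¹`,
`inv_add_sub_inv_eq`: `|G_k − G_{k+1}| ≤ (c_E·K₁′ + √(2ε_Ec_E)·K₂′)(√r)^k e^{−(κ∕2)d}` under the gap `ρ + ρ_B + 2c_EV < γ`) — the η-rate of the
background-dependent part VANISHES LINEARLY in the perturbation's size `(c_E, √(ε_Ec_E))`, at the SAME rate `√r` and SAME decay `κ∕2` as (4.38).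
Part 7b (`BalabanUVNodesN15KingModelPerturbedMixed`) fires §3 on King's tower BY NAME and reads it as `T4EtaRate.EtaRateIneqUnit` for the
background-dependent part of the dressed unit kernel with a constant LINEAR in the regularity size.

HONEST FRAMING ∕ LIMITS.  Finite index sets, entrywise currency with position-space decay; every statement is OUR bookkeeping ([folklore] algebra around
King's printed `A = 0` mechanism (4.39)–(4.41) p. 675 — print states neither a first-order nor a mixed estimate, and nothing at `A ≠ 0`: p. 670 «and A = 0,
of course»); the perturbation tower is ABSTRACT — for Bałaban's `E_k(U) = Δ^{(k)}(U) − Δ^{(k)}(1)` the two letters are the Spine's (H-bd)∕(H-cons) in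
position-space currency: NOT PRINTED ([B9] prints η-uniform bounds and analyticity in the background at FIXED spacing, Thm 3.4 p. 400, never an
η-difference), ASSERTED BY NOBODY (binders); no carrier of [B9]'s `C^{(k)}(Λ; U)` is constructed; no `def … : Prop` occurs.  NOT a node discharge; typed
28∕28, discharged count untouched; one finite torus programme at fixed ε — NOT ℝ⁴ ∕ infinite volume ∕ OS ∕ mass gap ∕ Clay.  Locators only: [King1986] =
C. King, CMP **102** (1986) 649–677, (4.33)–(4.34) p. 674, Lemma 4.5 (4.38) p. 674, (4.39)–(4.41) p. 675; [B9] = [Balaban1985BackgroundPropagators] CMP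
**99** (1985) (3.35)–(3.36) p. 396, Thm 3.4 p. 400, Thm 3.15 (3.187) p. 432.
-/

noncomputable section

open scoped BigOperators Matrix
open Finset

namespace Summit.QuantumFields.YangMills.BalabanUVNodes.N15.KingModel

open Literature.MathematicalPhysics.QuantumFieldTheory.Balaban1983to89
open Literature.MathematicalPhysics.QuantumFieldTheory.Balaban1983to89.QGQInverse (Coercive isUnit_of_coercive)
open Literature.MathematicalPhysics.QuantumFieldTheory.King1986 (wRow wCol abs_le_sqrt_mul_exp_half inv_sub_inv_of_isUnit)
open Summit.QuantumFields.BalabanUV.T4Continuum.NE2KingTransplant (IsPseudoMetric UniformCoercive UniformCTBound UniformKernelDecay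
  EffectiveOperatorSupRate VolumeSum CovarianceTowerRate covarianceTowerRate_of_leaves)

variable {n : Type*} [Fintype n] [DecidableEq n] {d : n → n → ℝ}

/-! ## §1 Kernel algebra: composition with a Combes–Thomas surplus, the telescoping identity, the perturbation's one-step difference with decay -/

section Kernel

omit [Fintype n] [DecidableEq n] in
/-- The constant of a decay bound is nonnegative (read it on the diagonal). [folklore] -/
theorem const_nonneg_of_decay (hd : IsPseudoMetric d) {M : Matrix n n ℝ} {c a : ℝ} (h : ∀ z w, |M z w| ≤ c * Real.exp (-(a * d z w)))
    (x : n) : 0 ≤ c := by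
  have h0 := h x x
  rw [hd.zero x, mul_zero, neg_zero, Real.exp_zero, mul_one] at h0
  exact (abs_nonneg _).trans h0

omit [DecidableEq n] in
/-- The volume sum is nonnegative (nonempty index set). [folklore] -/
theorem volume_nonneg_of_volumeSum {κ V : ℝ} (h4 : VolumeSum d κ V) (x : n) : 0 ≤ V :=
  (sum_nonneg fun _ _ => (Real.exp_pos _).le).trans (h4 x)

omit [DecidableEq n] in
/-- **COMPOSITION OF TWO DECAYING KERNELS, SURPLUS ON THE RIGHT.**  If `|P(x,w)| ≤ p·e^{−αd(x,w)}` and `|Q(w,y)| ≤ q·e^{−βd(w,y)}` with `δ ≤ α` and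
`δ + κ∕2 ≤ β` (the right factor has a spare `κ∕2` of decay for the summation), and `Σ_w e^{−(κ∕2)d(y,w)} ≤ V`, then `|(PQ)(x,y)| ≤ p·q·V·e^{−δd(x,y)}`
(triangle inequality `d(x,y) ≤ d(x,w) + d(w,y)`). [cite: King1986, (4.41) p.675 (the summation mechanism)] -/
theorem mul_entry_decay_right (hd : IsPseudoMetric d) {κ V δ α β p q : ℝ} (hδ : 0 ≤ δ) (hp : 0 ≤ p) (hα : δ ≤ α) (hβ : δ + κ / 2 ≤ β)
    {P Q : Matrix n n ℝ} (hP : ∀ x w, |P x w| ≤ p * Real.exp (-(α * d x w))) (hQ : ∀ w y, |Q w y| ≤ q * Real.exp (-(β * d w y)))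
    (h4 : VolumeSum d κ V) (x y : n) :
    |(P * Q) x y| ≤ p * q * V * Real.exp (-(δ * d x y)) := by
  have hq : 0 ≤ q := const_nonneg_of_decay hd hQ y
  have hpt : ∀ w, |P x w| * |Q w y| ≤ p * q * Real.exp (-(δ * d x y)) * Real.exp (-(κ / 2 * d y w)) := by
    intro w
    have tri := hd.tri x w y
    have hxw := hd.nonneg x w
    have hwy := hd.nonneg w y
    have key : Real.exp (-(α * d x w)) * Real.exp (-(β * d w y)) ≤ Real.exp (-(δ * d x y)) * Real.exp (-(κ / 2 * d y w)) := by
      rw [← Real.exp_add, ← Real.exp_add, hd.symm y w]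
      apply Real.exp_le_exp.mpr
      have e1 := mul_le_mul_of_nonneg_left tri hδ
      have e2 := mul_le_mul_of_nonneg_right hα hxw
      have e3 := mul_le_mul_of_nonneg_right hβ hwy
      rw [mul_add] at e1
      rw [add_mul] at e3
      linarith
    calc |P x w| * |Q w y| ≤ (p * Real.exp (-(α * d x w))) * (q * Real.exp (-(β * d w y))) :=
          mul_le_mul (hP x w) (hQ w y) (abs_nonneg _) (mul_nonneg hp (Real.exp_pos _).le)
      _ = p * q * (Real.exp (-(α * d x w)) * Real.exp (-(β * d w y))) := by ring
      _ ≤ p * q * (Real.exp (-(δ * d x y)) * Real.exp (-(κ / 2 * d y w))) := mul_le_mul_of_nonneg_left key (mul_nonneg hp hq)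
      _ = _ := by ring
  have hc : 0 ≤ p * q * Real.exp (-(δ * d x y)) := mul_nonneg (mul_nonneg hp hq) (Real.exp_pos _).le
  calc |(P * Q) x y| = |∑ w, P x w * Q w y| := by rw [Matrix.mul_apply]
    _ ≤ ∑ w, |P x w * Q w y| := abs_sum_le_sum_abs _ _
    _ = ∑ w, |P x w| * |Q w y| := sum_congr rfl fun w _ => abs_mul _ _
    _ ≤ ∑ w, p * q * Real.exp (-(δ * d x y)) * Real.exp (-(κ / 2 * d y w)) := sum_le_sum fun w _ => hpt w
    _ = p * q * Real.exp (-(δ * d x y)) * ∑ w, Real.exp (-(κ / 2 * d y w)) := by rw [mul_sum]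
    _ ≤ p * q * Real.exp (-(δ * d x y)) * V := mul_le_mul_of_nonneg_left (h4 y) hc
    _ = p * q * V * Real.exp (-(δ * d x y)) := by ring

omit [DecidableEq n] in
/-- **COMPOSITION OF TWO DECAYING KERNELS, SURPLUS ON THE LEFT**: `|P(x,w)| ≤ p·e^{−βd(x,w)}`, `|Q(w,y)| ≤ q·e^{−αd(w,y)}`, `δ ≤ α`, `δ + κ∕2 ≤ β`
⇒ `|(PQ)(x,y)| ≤ p·q·V·e^{−δd(x,y)}` (transpose of `mul_entry_decay_right`). [cite: King1986, (4.41) p.675 (the summation mechanism)] -/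
theorem mul_entry_decay_left (hd : IsPseudoMetric d) {κ V δ α β p q : ℝ} (hδ : 0 ≤ δ) (hα : δ ≤ α) (hβ : δ + κ / 2 ≤ β)
    {P Q : Matrix n n ℝ} (hP : ∀ x w, |P x w| ≤ p * Real.exp (-(β * d x w))) (hQ : ∀ w y, |Q w y| ≤ q * Real.exp (-(α * d w y)))
    (h4 : VolumeSum d κ V) (x y : n) :
    |(P * Q) x y| ≤ p * q * V * Real.exp (-(δ * d x y)) := by
  have hq : 0 ≤ q := const_nonneg_of_decay hd hQ y
  have h := mul_entry_decay_right (P := Q.transpose) (Q := P.transpose) hd hδ hq hα hβ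
    (fun a b => by rw [Matrix.transpose_apply, hd.symm a b]; exact hQ b a)
    (fun a b => by rw [Matrix.transpose_apply, hd.symm a b]; exact hP b a) h4 y x
  rw [← Matrix.transpose_mul, Matrix.transpose_apply, hd.symm y x] at h
  calc |(P * Q) x y| ≤ q * p * V * Real.exp (-(δ * d x y)) := h
    _ = p * q * V * Real.exp (-(δ * d x y)) := by ring

omit [Fintype n] [DecidableEq n] in
/-- **THE THREE-TERM TELESCOPING IDENTITY** `P′₁E₁Q₁ − P′₀E₀Q₀ = (P′₁ − P′₀)E₁Q₁ + P′₀(E₁ − E₀)Q₁ + P′₀E₀(Q₁ − Q₀)`. [folklore] -/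
theorem sandwich_telescope {m : Type*} [Fintype m] (P₁ P₀ E₁ E₀ Q₁ Q₀ : Matrix m m ℝ) :
    P₁ * E₁ * Q₁ - P₀ * E₀ * Q₀ = (P₁ - P₀) * E₁ * Q₁ + P₀ * (E₁ - E₀) * Q₁ + P₀ * E₀ * (Q₁ - Q₀) := by
  simp only [Matrix.sub_mul, Matrix.mul_sub]
  abel

omit [Fintype n] [DecidableEq n] in
/-- **THE PERTURBATION'S ONE-STEP DIFFERENCE, WITH DECAY, FROM ITS TWO LETTERS**: if `E` is k-uniformly local, `|E_k(z,w)| ≤ c_E e^{−2κd(z,w)}` (its (H2′)),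
and has the sup one-step rate `|E_{k+1} − E_k| ≤ ε_E r^k` (its (H3)), then `|(E_{k+1} − E_k)(z,w)| ≤ √(2ε_Ec_E)·(√r)^k·e^{−κd(z,w)}` — King's
`min ≤ geometric mean` step at every level. [cite: King1986, (4.41) p.675 («Combining Lemma 4.3 and the uniform exponential decay …»)] -/
theorem oneStep_decay_of_letters {E : ℕ → Matrix n n ℝ} {κ cE εE r : ℝ} (hεE : 0 ≤ εE) (hr : 0 ≤ r)
    (hE : UniformKernelDecay E d cE κ) (hE' : EffectiveOperatorSupRate E εE r) (k : ℕ) (z w : n) :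
    |(E (k + 1) - E k) z w| ≤ Real.sqrt (2 * (εE * cE)) * Real.sqrt r ^ k * Real.exp (-(κ * d z w)) := by
  have h1 : |(E (k + 1) - E k) z w| ≤ εE * r ^ k := hE' k z w
  have h2 : |(E (k + 1) - E k) z w| ≤ 2 * cE * Real.exp (-(2 * κ * d z w)) := by
    rw [Matrix.sub_apply]
    calc |E (k + 1) z w - E k z w| ≤ |E (k + 1) z w| + |E k z w| := abs_sub _ _
      _ ≤ cE * Real.exp (-(2 * κ * d z w)) + cE * Real.exp (-(2 * κ * d z w)) := add_le_add (hE (k + 1) z w) (hE k z w)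
      _ = 2 * cE * Real.exp (-(2 * κ * d z w)) := by ring
  have h := abs_le_sqrt_mul_exp_half (mul_nonneg hεE (pow_nonneg hr k)) h1 h2
  have hsq : Real.sqrt (r ^ k) = Real.sqrt r ^ k := by
    have h0 : 0 ≤ Real.sqrt r ^ k := pow_nonneg (Real.sqrt_nonneg r) k
    have e : r ^ k = (Real.sqrt r ^ k) ^ 2 := by rw [← pow_mul, mul_comm, pow_mul, Real.sq_sqrt hr]
    rw [e, Real.sqrt_sq h0]
  have hs : Real.sqrt (εE * r ^ k * (2 * cE)) = Real.sqrt (2 * (εE * cE)) * Real.sqrt r ^ k := by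
    rw [show εE * r ^ k * (2 * cE) = (2 * (εE * cE)) * r ^ k by ring, Real.sqrt_mul' _ (pow_nonneg hr k), hsq]
  have e2 : 2 * κ / 2 * d z w = κ * d z w := by ring
  rwa [hs, e2] at h

end Kernel

/-! ## §2 The sandwich rate -/

section Sandwich

omit [DecidableEq n] in
/-- **THE SANDWICH RATE (kernel-checked).**  Three towers on a finite index set with pseudo-metric `d` and volume sum `V` (at `κ∕2`): the OUTER towers
`P′, Q` decay at rate `κ` (`|P′_k| ≤ a′e^{−κd}`, `|Q_k| ≤ ae^{−κd}`) and have one-step rates at decay `κ∕2` (`|P′_{k+1} − P′_k| ≤ c′s^k e^{−(κ∕2)d}`,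
`|Q_{k+1} − Q_k| ≤ cs^k e^{−(κ∕2)d}`) — the shape of the socket's ROOT `CovarianceTowerRate` —, the MIDDLE tower `E` is local at `2κ` (`|E_k| ≤ c_E e^{−2κd}`)
with one-step rate `|E_{k+1} − E_k| ≤ e_E s^k e^{−κd}`.  THEN at every level and all sites
`|(P′_{k+1}E_{k+1}Q_{k+1} − P′_kE_kQ_k)(x,y)| ≤ (c′·c_E·a + a′·e_E·a + a′·c_E·c)·V²·s^k·e^{−(κ∕2)d(x,y)}` — LINEAR in the middle tower's size `(c_E, e_E)`.
Proof = `sandwich_telescope` + two compositions per term (`mul_entry_decay_right`∕`_left`). [cite: King1986, (4.39)–(4.41) p.675 (the mechanism, at A = 0)] -/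
theorem sandwich_rate (hd : IsPseudoMetric d) (P' E Q : ℕ → Matrix n n ℝ) {κ V s a' a c' c cE eE : ℝ} (hκ : 0 ≤ κ) (hs : 0 ≤ s)
    (hc' : 0 ≤ c') (hcE : 0 ≤ cE) (heE : 0 ≤ eE)
    (hP'dec : ∀ k x w, |P' k x w| ≤ a' * Real.exp (-(κ * d x w))) (hQdec : ∀ k w y, |Q k w y| ≤ a * Real.exp (-(κ * d w y)))
    (hP'rate : ∀ k x w, |(P' (k + 1) - P' k) x w| ≤ c' * s ^ k * Real.exp (-(κ / 2 * d x w)))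
    (hQrate : ∀ k w y, |(Q (k + 1) - Q k) w y| ≤ c * s ^ k * Real.exp (-(κ / 2 * d w y)))
    (hEdec : UniformKernelDecay E d cE κ) (hErate : ∀ k z w, |(E (k + 1) - E k) z w| ≤ eE * s ^ k * Real.exp (-(κ * d z w)))
    (h4 : VolumeSum d κ V) (k : ℕ) (x y : n) :
    |(P' (k + 1) * E (k + 1) * Q (k + 1) - P' k * E k * Q k) x y|
      ≤ (c' * cE * a + a' * eE * a + a' * cE * c) * V ^ 2 * s ^ k * Real.exp (-(κ / 2 * d x y)) := by
  have hV := volume_nonneg_of_volumeSum h4 x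
  have ha' : 0 ≤ a' := const_nonneg_of_decay hd (hP'dec 0) x
  have hsk : 0 ≤ s ^ k := pow_nonneg hs k
  have hκ2 : 0 ≤ κ / 2 := by linarith
  have hβ1 : κ / 2 + κ / 2 ≤ 2 * κ := by linarith
  have hβ2 : κ / 2 + κ / 2 ≤ κ := by linarith
  have hβ3 : κ + κ / 2 ≤ 2 * κ := by linarith
  -- term 1: ((P′⁺ − P′) E⁺) Q⁺
  have t1a : ∀ u v, |((P' (k + 1) - P' k) * E (k + 1)) u v| ≤ c' * s ^ k * cE * V * Real.exp (-(κ / 2 * d u v)) :=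
    mul_entry_decay_right hd hκ2 (mul_nonneg hc' hsk) le_rfl hβ1 (hP'rate k) (hEdec (k + 1)) h4
  have t1 : |((P' (k + 1) - P' k) * E (k + 1) * Q (k + 1)) x y| ≤ c' * s ^ k * cE * V * a * V * Real.exp (-(κ / 2 * d x y)) :=
    mul_entry_decay_right hd hκ2 (by positivity) le_rfl hβ2 t1a (hQdec (k + 1)) h4 x y
  -- term 2: (P′ (E⁺ − E)) Q⁺
  have t2a : ∀ u v, |(P' k * (E (k + 1) - E k)) u v| ≤ a' * (eE * s ^ k) * V * Real.exp (-(κ / 2 * d u v)) :=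
    mul_entry_decay_right hd hκ2 ha' (by linarith) hβ2 (hP'dec k) (hErate k) h4
  have t2 : |(P' k * (E (k + 1) - E k) * Q (k + 1)) x y| ≤ a' * (eE * s ^ k) * V * a * V * Real.exp (-(κ / 2 * d x y)) :=
    mul_entry_decay_right hd hκ2 (by positivity) le_rfl hβ2 t2a (hQdec (k + 1)) h4 x y
  -- term 3: (P′ E) (Q⁺ − Q), surplus on the left
  have t3a : ∀ u v, |(P' k * E k) u v| ≤ a' * cE * V * Real.exp (-(κ * d u v)) :=
    mul_entry_decay_right hd hκ ha' le_rfl hβ3 (hP'dec k) (hEdec k) h4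
  have t3 : |(P' k * E k * (Q (k + 1) - Q k)) x y| ≤ a' * cE * V * (c * s ^ k) * V * Real.exp (-(κ / 2 * d x y)) :=
    mul_entry_decay_left hd hκ2 le_rfl hβ2 t3a (hQrate k) h4 x y
  rw [sandwich_telescope, Matrix.add_apply, Matrix.add_apply]
  calc |((P' (k + 1) - P' k) * E (k + 1) * Q (k + 1)) x y + (P' k * (E (k + 1) - E k) * Q (k + 1)) x y
          + (P' k * E k * (Q (k + 1) - Q k)) x y|
      ≤ |((P' (k + 1) - P' k) * E (k + 1) * Q (k + 1)) x y + (P' k * (E (k + 1) - E k) * Q (k + 1)) x y|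
          + |(P' k * E k * (Q (k + 1) - Q k)) x y| := abs_add_le _ _
    _ ≤ |((P' (k + 1) - P' k) * E (k + 1) * Q (k + 1)) x y| + |(P' k * (E (k + 1) - E k) * Q (k + 1)) x y|
          + |(P' k * E k * (Q (k + 1) - Q k)) x y| := by gcongr; exact abs_add_le _ _
    _ ≤ c' * s ^ k * cE * V * a * V * Real.exp (-(κ / 2 * d x y)) + a' * (eE * s ^ k) * V * a * V * Real.exp (-(κ / 2 * d x y))
          + a' * cE * V * (c * s ^ k) * V * Real.exp (-(κ / 2 * d x y)) := add_le_add (add_le_add t1 t2) t3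
    _ = (c' * cE * a + a' * eE * a + a' * cE * c) * V ^ 2 * s ^ k * Real.exp (-(κ / 2 * d x y)) := by ring

end Sandwich

/-! ## §3 On the five leaves: the first-order term and the background-dependent part of a dressed covariance -/

section Leaves

variable {D E : ℕ → Matrix n n ℝ} {B : Matrix n n ℝ}

omit [DecidableEq n] in
/-- The Combes–Thomas constants of (H2) are nonnegative (nonempty index set). [folklore] -/
theorem rho_nonneg_of_ctBound (hd : IsPseudoMetric d) {κ ρ ρB : ℝ} (hκ : 0 ≤ κ) (h2 : UniformCTBound D B d κ ρ ρB) (x : n) :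
    0 ≤ ρ ∧ 0 ≤ ρB := by
  obtain ⟨hr, -, hrB, -⟩ := h2
  have hw : ∀ (M : Matrix n n ℝ), 0 ≤ wRow M d κ x := fun M => sum_nonneg fun j _ => mul_nonneg (abs_nonneg _) (by
    have := Real.one_le_exp (mul_nonneg hκ (hd.nonneg x j)); linarith)
  exact ⟨(hw (D 0)).trans (hr 0 x), (hw B).trans (hrB x)⟩

/-- **η-RATE OF THE FIRST-ORDER BACKGROUND TERM (kernel-checked).**  For a tower `D` with block term `B` carrying the five leaves of the unit-layer socket
(`(γ, κ, ρ, ρ_B, C₁, ε, r, V)`, `ρ + ρ_B < γ`) and a perturbation tower `E` with the locality letter `|E_k| ≤ c_E e^{−2κd}` and the two-spacing letter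
`|E_{k+1} − E_k| ≤ ε_E r^k`, the first-order term `F_k := (D_k + B)⁻¹E_k(D_k + B)⁻¹` (`= −∂_t(D_k + tE_k + B)⁻¹|_{t=0}`) obeys, with `A = (γ − ρ − ρ_B)⁻¹` and
`C_F = √(2εC₁)A²V²` (the constant of (4.38)):
`|(F_{k+1} − F_k)(x,y)| ≤ (C_F·c_E·A + A·√(2ε_Ec_E)·A + A·c_E·C_F)·V²·(√r)^k·e^{−(κ∕2)d(x,y)}` — linear in the perturbation's size, same rate and decay as (4.38).
[cite: King1986, Lemma 4.5 (4.38) p.674, (4.39)–(4.41) p.675 (the mechanism, at A = 0)] -/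
theorem firstOrder_rate_of_leaves (hd : IsPseudoMetric d) {γ κ ρ ρB ε C₁ V r cE εE : ℝ} (hγ : ρ + ρB < γ) (hκ : 0 ≤ κ) (hε : 0 ≤ ε)
    (hr : 0 ≤ r) (hcE : 0 ≤ cE) (hεE : 0 ≤ εE)
    (h1 : UniformCoercive D B γ) (h2 : UniformCTBound D B d κ ρ ρB) (h2' : UniformKernelDecay D d C₁ κ) (h3 : EffectiveOperatorSupRate D ε r)
    (h4 : VolumeSum d κ V) (hE : UniformKernelDecay E d cE κ) (hE' : EffectiveOperatorSupRate E εE r) (k : ℕ) (x y : n) :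
    |((D (k + 1) + B)⁻¹ * E (k + 1) * (D (k + 1) + B)⁻¹ - (D k + B)⁻¹ * E k * (D k + B)⁻¹) x y|
      ≤ ((Real.sqrt (ε * (2 * C₁)) * ((γ - (ρ + ρB))⁻¹) ^ 2 * V ^ 2) * cE * (γ - (ρ + ρB))⁻¹
          + (γ - (ρ + ρB))⁻¹ * Real.sqrt (2 * (εE * cE)) * (γ - (ρ + ρB))⁻¹
          + (γ - (ρ + ρB))⁻¹ * cE * (Real.sqrt (ε * (2 * C₁)) * ((γ - (ρ + ρB))⁻¹) ^ 2 * V ^ 2))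
        * V ^ 2 * Real.sqrt r ^ k * Real.exp (-(κ / 2 * d x y)) := by
  have hroot := covarianceTowerRate_of_leaves D B d hd hγ hκ hε hr h1 h2 h2' h3 h4
  have hdec := inv_entry_decay_of_leaves hd hγ hκ h1 h2
  have hrate : ∀ k w y, |((D (k + 1) + B)⁻¹ - (D k + B)⁻¹) w y|
      ≤ Real.sqrt (ε * (2 * C₁)) * ((γ - (ρ + ρB))⁻¹) ^ 2 * V ^ 2 * Real.sqrt r ^ k * Real.exp (-(κ / 2 * d w y)) := fun k w y => by
    rw [Matrix.sub_apply, abs_sub_comm]; exact hroot k w y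
  have hV := volume_nonneg_of_volumeSum h4 x
  exact sandwich_rate hd (fun k => (D k + B)⁻¹) E (fun k => (D k + B)⁻¹) hκ (Real.sqrt_nonneg r) (by positivity) hcE (Real.sqrt_nonneg _)
    hdec hdec hrate hrate hE (oneStep_decay_of_letters hεE hr hE hE') h4 k x y

/-- **RESOLVENT IDENTITY FOR A DRESSED OPERATOR**: for units `A`, `A + E`, `(A + E)⁻¹ − A⁻¹ = −(A + E)⁻¹·E·A⁻¹`. [folklore] -/
theorem inv_add_sub_inv_eq {A E : Matrix n n ℝ} (hA : IsUnit A) (hAE : IsUnit (A + E)) :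
    (A + E)⁻¹ - A⁻¹ = -((A + E)⁻¹ * E * A⁻¹) := by
  rw [inv_sub_inv_of_isUnit _ _ hAE hA, show A - (A + E) = -E by abel, Matrix.mul_neg, Matrix.neg_mul]

/-- **η-RATE OF THE BACKGROUND-DEPENDENT PART OF A DRESSED COVARIANCE (the MIXED estimate; kernel-checked).**  With the five leaves of `D, B` and the two
letters of `E` as in `firstOrder_rate_of_leaves`, under the gap `ρ + ρ_B + 2c_EV < γ`, the background-dependent part `G_k := (D_k + E_k + B)⁻¹ − (D_k + B)⁻¹`
(`= −(D_k + E_k + B)⁻¹E_k(D_k + B)⁻¹`) obeys, with `A = (γ − ρ − ρ_B)⁻¹`, `A′ = (γ − ρ − ρ_B − 2c_EV)⁻¹`, `C_F = √(2εC₁)A²V²` and the dressed constant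
`C_E′ = √((ε + ε_E)·2(C₁ + c_E))A′²V²`:
`|(G_k − G_{k+1})(x,y)| ≤ (C_E′·c_E·A + A′·√(2ε_Ec_E)·A + A′·c_E·C_F)·V²·(√r)^k·e^{−(κ∕2)d(x,y)}` — the η-rate of the background-dependent part VANISHES
LINEARLY in the perturbation's size `(c_E, √(ε_Ec_E))`, at the rate and decay of (4.38).  (King's (4.39)–(4.41) used thrice: dressed root of part 6a,
free root of b2b's socket, and the sandwich.) [cite: King1986, Lemma 4.5 (4.38) p.674, (4.39)–(4.41) p.675 (the mechanism, at A = 0); Balaban1985BackgroundPropagators, Thm 3.4 p.400 (analytic dependence on the background at fixed spacing: the shape being differenced)] -/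
theorem mixed_rate_of_leaves (hd : IsPseudoMetric d) {γ κ ρ ρB ε C₁ V r cE εE : ℝ} (hgap : ρ + ρB + 2 * (cE * V) < γ) (hκ : 0 ≤ κ)
    (hε : 0 ≤ ε) (hr : 0 ≤ r) (hcE : 0 ≤ cE) (hεE : 0 ≤ εE)
    (h1 : UniformCoercive D B γ) (h2 : UniformCTBound D B d κ ρ ρB) (h2' : UniformKernelDecay D d C₁ κ) (h3 : EffectiveOperatorSupRate D ε r)
    (h4 : VolumeSum d κ V) (hE : UniformKernelDecay E d cE κ) (hE' : EffectiveOperatorSupRate E εE r) (k : ℕ) (x y : n) :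
    |(((D k + E k + B)⁻¹ - (D k + B)⁻¹) - ((D (k + 1) + E (k + 1) + B)⁻¹ - (D (k + 1) + B)⁻¹)) x y|
      ≤ ((Real.sqrt ((ε + εE) * (2 * (C₁ + cE))) * (((γ - cE * V) - ((ρ + cE * V) + ρB))⁻¹) ^ 2 * V ^ 2) * cE * (γ - (ρ + ρB))⁻¹
          + ((γ - cE * V) - ((ρ + cE * V) + ρB))⁻¹ * Real.sqrt (2 * (εE * cE)) * (γ - (ρ + ρB))⁻¹
          + ((γ - cE * V) - ((ρ + cE * V) + ρB))⁻¹ * cE * (Real.sqrt (ε * (2 * C₁)) * ((γ - (ρ + ρB))⁻¹) ^ 2 * V ^ 2))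
        * V ^ 2 * Real.sqrt r ^ k * Real.exp (-(κ / 2 * d x y)) := by
  have hV := volume_nonneg_of_volumeSum h4 x
  have hcV : 0 ≤ cE * V := mul_nonneg hcE hV
  obtain ⟨hρ, hρB⟩ := rho_nonneg_of_ctBound hd hκ h2 x
  have hγ : ρ + ρB < γ := by linarith
  have hγ0 : 0 < γ := by linarith
  have hγE : 0 < γ - cE * V := by linarith
  have hgap' : (ρ + cE * V) + ρB < γ - cE * V := by linarith
  -- the free tower: decay and root
  have hdec := inv_entry_decay_of_leaves hd hγ hκ h1 h2
  have hroot := covarianceTowerRate_of_leaves D B d hd hγ hκ hε hr h1 h2 h2' h3 h4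
  have hrate : ∀ k w y, |((D (k + 1) + B)⁻¹ - (D k + B)⁻¹) w y|
      ≤ Real.sqrt (ε * (2 * C₁)) * ((γ - (ρ + ρB))⁻¹) ^ 2 * V ^ 2 * Real.sqrt r ^ k * Real.exp (-(κ / 2 * d w y)) := fun k w y => by
    rw [Matrix.sub_apply, abs_sub_comm]; exact hroot k w y
  -- the dressed tower: leaves, decay and root (part 6a)
  obtain ⟨g1, g2, -, -, -⟩ := perturbedLeaves hd hκ hcE h1 h2 h2' h3 h4 hE hE'
  have hdecE : ∀ k x w, |(D k + E k + B)⁻¹ x w| ≤ ((γ - cE * V) - ((ρ + cE * V) + ρB))⁻¹ * Real.exp (-(κ * d x w)) := fun k x w => by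
    have h := inv_entry_decay_of_leaves hd hgap' hκ g1 g2 k x w
    rwa [Pi.add_apply] at h
  have hrootE := covarianceTowerRate_add_of_leaves hd hκ hcE hε hεE hr hgap h1 h2 h2' h3 h4 hE hE'
  have hrateE : ∀ k x w, |((D (k + 1) + E (k + 1) + B)⁻¹ - (D k + E k + B)⁻¹) x w|
      ≤ Real.sqrt ((ε + εE) * (2 * (C₁ + cE))) * (((γ - cE * V) - ((ρ + cE * V) + ρB))⁻¹) ^ 2 * V ^ 2 * Real.sqrt r ^ k
          * Real.exp (-(κ / 2 * d x w)) := fun k x w => by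
    have h := hrootE k x w
    rw [Pi.add_apply, Pi.add_apply] at h
    rw [Matrix.sub_apply, abs_sub_comm]; exact h
  -- the resolvent identity at both levels
  have hunit : ∀ k, IsUnit (D k + B) := fun k => isUnit_of_coercive hγ0 (h1 k)
  have hunitE : ∀ k, IsUnit (D k + B + E k) := fun k => by
    have h := g1 k
    rw [Pi.add_apply, show D k + E k + B = D k + B + E k by abel] at h
    exact isUnit_of_coercive hγE h
  have hG : ∀ k, (D k + E k + B)⁻¹ - (D k + B)⁻¹ = -((D k + E k + B)⁻¹ * E k * (D k + B)⁻¹) := fun k => by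
    have h := inv_add_sub_inv_eq (hunit k) (hunitE k)
    rwa [show D k + B + E k = D k + E k + B by abel] at h
  have e : ((D k + E k + B)⁻¹ - (D k + B)⁻¹) - ((D (k + 1) + E (k + 1) + B)⁻¹ - (D (k + 1) + B)⁻¹)
      = (D (k + 1) + E (k + 1) + B)⁻¹ * E (k + 1) * (D (k + 1) + B)⁻¹ - (D k + E k + B)⁻¹ * E k * (D k + B)⁻¹ := by
    rw [hG k, hG (k + 1)]; abel
  rw [e]
  exact sandwich_rate hd (fun k => (D k + E k + B)⁻¹) E (fun k => (D k + B)⁻¹) hκ (Real.sqrt_nonneg r) (by positivity) hcE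
    (Real.sqrt_nonneg _) hdecE hdec hrateE hrate hE (oneStep_decay_of_letters hεE hr hE hE') h4 k x y

end Leaves

end Summit.QuantumFields.YangMills.BalabanUVNodes.N15.KingModel

end
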